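import Summits.QuantumFields.YangMills.Theorems.UnitScaleTiltProp7AxialHolderLetterGlue
import HarnessLib

/-!
# Route `UnitScaleTilt`, crux K1 «MinimiserStabilityRegPr» (stmt-QuantumFields-19200), EX row (5) `h3` (STOREY H), H-ROAD brick **H2b-WALK: THE MODULUS OF THE AXIAL TRANSPORTER
# IN A REGULAR GAUGE** — `‖σ_c(e⁻¹y′) − σ_c(e⁻¹y)‖ ≤ 12(48ε₀ + a)·(tdist y y′∕ℓ)^{1∕2}` on the balls `tdist (e c) · ≤ 4ℓ+1`, `σ_c = axialT U₀ c`, for a background with small plaquettes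
# (`RegPr`'s first clause) whose links are `aη`-close to `1` IN THE GIVEN GAUGE (the small-field clause of [Balaban1985RegularSpaces] Thm 2 = S47's `hThm2S`), on a member with the
# no-wrap room `2(12ℓ+5) ≤ sitesPerDir 0` (T1-core's class; on the `L³`-fold cover it holds, ✓`room_cover_three`) — the `hΛ` letter of H2b-GLUE ✓∕⧗`Prop7AxialHolderLetterGlue`.

Cell `ym3-torus` (HUMAN RULING D-0037; rung R3 = SU(2) YM₃ on T³ — NOT d = 4, NOT infinite volume, NOT a mass gap, NOT Clay).  Width seat `ym3-torus-px13` (gen 16);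
`--supports stmt-QuantumFields-19200 --as helper`; count-neutral; THEOREMS ONLY (0 `def`, 0 `sorry`, default heartbeats).

HOW.  H2b-GLUE §1 ✓`norm_coe_transf_tgt_sub_le` bounds ONE lattice step of any gauge transformation by the two link deviations `‖U₀^σ(b) − 1‖ + ‖U₀(b) − 1‖`; at `σ := σ_c` the first is
the axial smallness `3R·ε₀η²` on the no-wrap ball of radius `R = 12ℓ + 4` (✓`Prop7CurvedMemberBallLetters.norm_bgOfCfg_axialT_sub_one_le_of_ball`, plaquettes only; `ℓ·3Rε₀η² ≤ 48ε₀`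
✓`ell_mul_delta_ball_le`) and the second is `aη`.  §1–§2 walk: the target `x′ = x + t`, `t = rel x x′` (`|t|_∞ ≤ tdist`, ✓`AxialGaugeChartGlue.natAbs_rel_le_tdist_siteEquiv`), is reached
from `x` by `|t|₁ ≤ 3·tdist` unit steps `transl x (· ± e_κ)` (lit ✓`transl_add_e`), every intermediate point staying within `|t|_∞` of `x` (✓`AxialGaugeTorusTransfer.rel_transl_of_box`,
room) hence within `12ℓ + 3` of `e c`; §3 sums the steps and converts `3(48ε₀ + a)·(d∕ℓ) ≤ 12(48ε₀ + a)·(d∕ℓ)^{1∕2}` (`d ≤ 8ℓ + 2 ≤ 9ℓ`).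

WHAT IS PROVED (ns `Summit.QuantumFields.YangMills.Theorems.Prop7AxialTransporterModulus`; member `F`, run `K`).
* §1 `tdist_siteEquiv_transl_le` — `tdist (e x) (e (x + t)) ≤ T` for `|t|_∞ ≤ T`, `2(T+1) ≤ sitesPerDir 0`.
* §2 ★ `norm_sub_le_of_steps` — THE WALK: for any `f : Site → E` with `‖f(z + e_κ) − f(z)‖ ≤ β` on the ball `tdist (e c) (e z) ≤ R`, a base point `x` with `tdist (e c)(e x) ≤ R₀`,
  `R₀ + T ≤ R`, `2(T+1) ≤ sitesPerDir 0`: `‖f(x + t) − f(x)‖ ≤ |t|₁·β` for `|t|_∞ ≤ T` (induction on `|t|₁`).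
* §3 ★★ `norm_axialT_sub_le_of_smallField_ball` — PER CENTRE `c`, the small-field clause ON THE BALL `tdist (e c)(e b₋) ≤ 12ℓ+4` ONLY (the dischargeable, LOCAL edition:
  print's (3.35) is local); ★★ `norm_axialT_sub_le_of_smallField` — the `hΛ` letter of H2b-GLUE (all centres) from a GLOBAL clause `∀ b, ‖U₀(b) − 1‖ ≤ a·η`, `Λ := 12·(48ε₀ + a)`.
HYP-SAT (★★OWNER RULING №42).  `PlaqSmall` = `RegPr`'s first clause (print's (8)); the small-field clause is (1.36) of [Balaban1985RegularSpaces] Thm 2 in the gauge it produces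
(inhabited by `hThm2S`; at `U₀ = 1` trivially with `a = 0`); the room is T1-core's (CHAIR WORD №1 class; the cover has it); conclusion non-vacuous; no `Prop` hypothesis restates it.
HONEST SCOPE: lattice bookkeeping + the triangle inequality; the Thm-2 gauge is NOT constructed here; nothing of H2, `h3`, EX, 19200 or the rung; the Yang–Mills mass gap is NOT proved.

References: T. Bałaban, CMP **98** (1985) 17–51 [Balaban1985Averaging] ((8) p.19, pp.24–25 «|V₀(b) − 1| < |b₋ − y|α₀»); CMP **102** (1985) 255–275 [Balaban1985RegularSpaces]
((1.36) p.82, Thm 2 p.83); CMP **99** (1985) 389–434 [Balaban1985BackgroundPropagators] ((3.35) p.396); CMP **109** (1987) 249–301 [Balaban1985UV3] ((27) p.263).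
-/

set_option autoImplicit false

noncomputable section

open scoped BigOperators Matrix.Norms.L2Operator

namespace Summit.QuantumFields.YangMills.Theorems.Prop7AxialTransporterModulus

open Literature.MathematicalPhysics.QuantumFieldTheory.Balaban1983to89
open Literature.MathematicalPhysics.QuantumFieldTheory.Balaban1983to89.T3ContinuumYM3Torus
open B10Eq27TorusAxialLog (axialT transl rel transl_rel transl_zero transl_add_e)
open B7Prop1Explicit (e e_apply)
open B4Sect5Torus (TSite tdist tdist_triangle tdist_symm tdist_nonneg)
open T3RegularMinimiser (regThreshold)
open T3SectALandauChart (eta eta_pos)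
open Summit.QuantumFields.YangMills.Theorems.Prop7SectET3Transport (periodsT3 siteEquiv bgOfCfg)
open Summit.QuantumFields.YangMills.Theorems.Prop7TwoBackgroundGradientComparison (one_le_periodsT3)
open Summit.QuantumFields.YangMills.Theorems.AxialGaugeChartGlue (tdist_siteEquiv natAbs_rel_le_tdist_siteEquiv val_bgOfCfg_pair)
open Summit.QuantumFields.YangMills.Theorems.AxialGaugeTorusTransfer (rel_transl_of_box)
open Summit.QuantumFields.YangMills.Theorems.Prop7CurvedMemberBallLetters (natCast_radius norm_bgOfCfg_axialT_sub_one_le_of_ball ell_mul_delta_ball_le)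
open Summit.QuantumFields.YangMills.Theorems.Prop7AxialHolderLetterGlue (norm_coe_transf_tgt_sub_le)

variable (F : T3Family) (n K : ℕ)

/-! ## §1 Translations inside the no-wrap window move the carrier distance by at most `|t|_∞` -/

/-- `tdist (e x) (e (x + t)) ≤ T` for `|t_κ| ≤ T` and `2(T+1) ≤ sitesPerDir 0` (`rel x (x + t) = t`, no wrap-around). [cite: Balaban1985UV3, (27) p.263] -/
theorem tdist_siteEquiv_transl_le (x : Site (F.P K) 0) {T : ℕ} (hT : 2 * (T + 1) ≤ (F.P K).sitesPerDir 0)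
    (t : B7Prop1Explicit.Site (F.P K).d) (ht : ∀ κ, |t κ| ≤ (T : ℤ)) :
    tdist (periodsT3 F K) (siteEquiv F K x) (siteEquiv F K (transl x t)) ≤ T := by
  rw [tdist_siteEquiv, rel_transl_of_box x hT t ht]
  have h : (Finset.univ.sup fun κ : Fin (F.P K).d => (t κ).natAbs) ≤ T := Finset.sup_le fun κ _ => by
    have := ht κ; rw [Int.abs_eq_natAbs] at this; exact_mod_cast this
  exact_mod_cast h

/-! ## §2 ★ The walk: `|t|₁` unit steps inside the ball -/

/-- ★ **THE WALK.**  For `f : Site → E` with `‖f(z + e_κ) − f(z)‖ ≤ β` at every `z` of the ball `tdist (e c) (e z) ≤ R` and every `κ`, a base point `x` with `tdist (e c) (e x) ≤ R₀`,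
and `R₀ + T ≤ R`, `2(T+1) ≤ sitesPerDir 0`: every `t` with `|t|_∞ ≤ T` has `‖f(x + t) − f(x)‖ ≤ |t|₁·β` — induction on `|t|₁`, peeling one unit step `t = t′ ± e_κ` (lit ✓`transl_add_e`),
the intermediate points staying within `T` of `x` (§1). [cite: Balaban1985Averaging, pp.24-25] -/
theorem norm_sub_le_of_steps {E : Type*} [SeminormedAddCommGroup E] (c x : Site (F.P K) 0) (f : Site (F.P K) 0 → E) {β R₀ R : ℝ} {T : ℕ}
    (hstep : ∀ (z : Site (F.P K) 0) (κ : Fin (F.P K).d), tdist (periodsT3 F K) (siteEquiv F K c) (siteEquiv F K z) ≤ R → ‖f (z.shift κ) - f z‖ ≤ β)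
    (hx : tdist (periodsT3 F K) (siteEquiv F K c) (siteEquiv F K x) ≤ R₀) (hRT : R₀ + T ≤ R) (hT : 2 * (T + 1) ≤ (F.P K).sitesPerDir 0) :
    ∀ (t : B7Prop1Explicit.Site (F.P K).d), (∀ κ, |t κ| ≤ (T : ℤ)) → ‖f (transl x t) - f x‖ ≤ (∑ κ, (t κ).natAbs : ℕ) * β := by
  have hP1 : ∀ i, 1 ≤ periodsT3 F K i := one_le_periodsT3 F K
  -- every translate within the window stays in the ball
  have hball : ∀ t : B7Prop1Explicit.Site (F.P K).d, (∀ κ, |t κ| ≤ (T : ℤ)) → tdist (periodsT3 F K) (siteEquiv F K c) (siteEquiv F K (transl x t)) ≤ R := by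
    intro t ht
    have h1 := tdist_siteEquiv_transl_le F K x hT t ht
    have h2 := tdist_triangle hP1 (siteEquiv F K c) (siteEquiv F K x) (siteEquiv F K (transl x t))
    linarith
  -- induction on `|t|₁`
  suffices h : ∀ (m : ℕ) (t : B7Prop1Explicit.Site (F.P K).d), (∑ κ, (t κ).natAbs) = m → (∀ κ, |t κ| ≤ (T : ℤ)) → ‖f (transl x t) - f x‖ ≤ (m : ℝ) * β by
    intro t ht; exact h _ t rfl ht
  intro m
  induction m with
  | zero =>
    intro t hm _
    have ht0 : t = 0 := by
      funext κ
      have := Finset.sum_eq_zero_iff.mp hm κ (Finset.mem_univ κ)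
      simpa using this
    rw [ht0, transl_zero, sub_self, norm_zero, Nat.cast_zero, zero_mul]
  | succ m ih =>
    intro t hm ht
    -- a coordinate that still has to move
    obtain ⟨κ, hκ⟩ : ∃ κ, t κ ≠ 0 := by
      by_contra hno
      simp only [not_exists, not_not] at hno
      have : (∑ κ, (t κ).natAbs) = 0 := Finset.sum_eq_zero fun κ _ => by rw [hno κ, Int.natAbs_zero]
      omega
    have hβ0 : 0 ≤ β := by
      have := hstep x 0 (hx.trans (by have : (0 : ℝ) ≤ T := Nat.cast_nonneg _; linarith))
      exact (norm_nonneg _).trans this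
    -- the sum over the other coordinates
    have hsplit : ∀ s : B7Prop1Explicit.Site (F.P K).d, (∑ κ', (s κ').natAbs) = (s κ).natAbs + ∑ κ' ∈ Finset.univ.erase κ, (s κ').natAbs :=
      fun s => (Finset.add_sum_erase Finset.univ (fun κ' => (s κ').natAbs) (Finset.mem_univ κ)).symm
    rcases lt_or_gt_of_ne hκ with hneg | hpos
    · -- `t_κ < 0`: `t′ := t + e_κ`, `x + t′ = (x + t) + e_κ`
      set t' : B7Prop1Explicit.Site (F.P K).d := t + e κ with ht'
      have ht'κ : t' κ = t κ + 1 := by rw [ht', Pi.add_apply, e_apply, if_pos rfl]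
      have ht'o : ∀ κ', κ' ≠ κ → t' κ' = t κ' := fun κ' h => by rw [ht', Pi.add_apply, e_apply, if_neg h, add_zero]
      have hm' : (∑ κ', (t' κ').natAbs) = m := by
        have h1 := hsplit t
        have h2 := hsplit t'
        have h3 : ∑ κ' ∈ Finset.univ.erase κ, (t' κ').natAbs = ∑ κ' ∈ Finset.univ.erase κ, (t κ').natAbs :=
          Finset.sum_congr rfl fun κ' hκ' => by rw [ht'o κ' (Finset.ne_of_mem_erase hκ')]
        have h4 : (t' κ).natAbs + 1 = (t κ).natAbs := by rw [ht'κ]; omega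
        omega
      have ht'T : ∀ κ', |t' κ'| ≤ (T : ℤ) := by
        intro κ'
        by_cases h : κ' = κ
        · subst h; rw [ht'κ]; have := ht κ'; rw [abs_le] at this ⊢; constructor <;> omega
        · rw [ht'o κ' h]; exact ht κ'
      have hstep' : ‖f (transl x t') - f (transl x t)‖ ≤ β := by
        rw [ht', transl_add_e]; exact hstep _ κ (hball t ht)
      have hih := ih t' hm' ht'T
      calc ‖f (transl x t) - f x‖ ≤ ‖f (transl x t) - f (transl x t')‖ + ‖f (transl x t') - f x‖ := norm_sub_le_norm_sub_add_norm_sub _ _ _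
        _ ≤ β + (m : ℝ) * β := add_le_add (by rw [norm_sub_rev]; exact hstep') hih
        _ = ((m + 1 : ℕ) : ℝ) * β := by push_cast; ring
    · -- `t_κ > 0`: `t′ := t − e_κ`, `x + t = (x + t′) + e_κ`
      set t' : B7Prop1Explicit.Site (F.P K).d := t - e κ with ht'
      have ht'κ : t' κ = t κ - 1 := by rw [ht', Pi.sub_apply, e_apply, if_pos rfl]
      have ht'o : ∀ κ', κ' ≠ κ → t' κ' = t κ' := fun κ' h => by rw [ht', Pi.sub_apply, e_apply, if_neg h, sub_zero]
      have hm' : (∑ κ', (t' κ').natAbs) = m := by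
        have h1 := hsplit t
        have h2 := hsplit t'
        have h3 : ∑ κ' ∈ Finset.univ.erase κ, (t' κ').natAbs = ∑ κ' ∈ Finset.univ.erase κ, (t κ').natAbs :=
          Finset.sum_congr rfl fun κ' hκ' => by rw [ht'o κ' (Finset.ne_of_mem_erase hκ')]
        have h4 : (t' κ).natAbs + 1 = (t κ).natAbs := by rw [ht'κ]; omega
        omega
      have ht'T : ∀ κ', |t' κ'| ≤ (T : ℤ) := by
        intro κ'
        by_cases h : κ' = κ
        · subst h; rw [ht'κ]; have := ht κ'; rw [abs_le] at this ⊢; constructor <;> omega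
        · rw [ht'o κ' h]; exact ht κ'
      have htt' : transl x t = (transl x t').shift κ := by rw [← transl_add_e, ht', sub_add_cancel]
      have hstep' : ‖f (transl x t) - f (transl x t')‖ ≤ β := by
        rw [htt']; exact hstep _ κ (hball t' ht'T)
      have hih := ih t' hm' ht'T
      calc ‖f (transl x t) - f x‖ ≤ ‖f (transl x t) - f (transl x t')‖ + ‖f (transl x t') - f x‖ := norm_sub_le_norm_sub_add_norm_sub _ _ _
        _ ≤ β + (m : ℝ) * β := add_le_add hstep' hih
        _ = ((m + 1 : ℕ) : ℝ) * β := by push_cast; ring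

/-! ## §3 ★★ The `hΛ` letter: the axial transporter of a regular-gauge field is Lipschitz on the balls -/

/-- ★★ **THE MODULUS OF THE AXIAL TRANSPORTER AT ONE CENTRE, SMALL FIELD ON THAT BALL ONLY** (per-centre edition of the `hΛ` letter of H2b-GLUE ✓`Prop7AxialHolderLetterGlue.hHω_of_plain_of_transporter`, `Λ := 12(48ε₀ + a)`).
For `U₀` with `PlaqSmall (regThreshold F n K ε₀) U₀` (`0 ≤ ε₀`), the small-field clause `‖U₀(b) − 1‖ ≤ a·η` (`0 ≤ a`) ON THE BALL `tdist (e c) (e b₋) ≤ 12ℓ+4` ONLY (a LOCAL regular gauge suffices — print's (3.35) is local)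
and the room `2(12ℓ+5) ≤ sitesPerDir 0`: on the ball `tdist (e c) · ≤ 4ℓ+1`, `‖σ_c(e⁻¹y′) − σ_c(e⁻¹y)‖ ≤ 12(48ε₀ + a)·(tdist y y′∕ℓ)^{1∕2}`, `σ_c = axialT U₀ c` — per step H2b-GLUE §1 (axial smallness `3R·ε₀η²`
✓`norm_bgOfCfg_axialT_sub_one_le_of_ball` + `aη`), `≤ 3·tdist` steps by §2, `ℓ·3Rε₀η² ≤ 48ε₀` ✓`ell_mul_delta_ball_le`, `ℓη = 1`, and `r ≤ 4√r` for `r = d∕ℓ ≤ 16`.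
[cite: Balaban1985Averaging, pp.24-25; Balaban1985RegularSpaces, (1.36) p.82, Thm 2 p.83; Balaban1985BackgroundPropagators, (3.35) p.396] -/
theorem norm_axialT_sub_le_of_smallField_ball {ε₀ a : ℝ} (hε₀ : 0 ≤ ε₀) (ha : 0 ≤ a)
    (U₀ : GaugeField (F.P K) 0 (Matrix.specialUnitaryGroup (Fin 2) ℂ)) (hP : PlaqSmall (regThreshold F n K ε₀) U₀) (c : Site (F.P K) 0)
    (hsf : ∀ b : PBond (F.P K) 0, tdist (periodsT3 F K) (siteEquiv F K c) (siteEquiv F K b.src) ≤ 12 * (F.L : ℝ) ^ (K - n) + 4 →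
      ‖((U₀ b : Matrix.specialUnitaryGroup (Fin 2) ℂ) : Matrix (Fin 2) (Fin 2) ℂ) - 1‖ ≤ a * eta F n K)
    (hroom : 2 * (12 * F.L ^ (K - n) + 5) ≤ (F.P K).sitesPerDir 0) :
    ∀ (y y' : TSite 3 (periodsT3 F K)),
      tdist (periodsT3 F K) (siteEquiv F K c) y ≤ 4 * (F.L : ℝ) ^ (K - n) + 1 → tdist (periodsT3 F K) (siteEquiv F K c) y' ≤ 4 * (F.L : ℝ) ^ (K - n) + 1 →
      ‖((axialT U₀ c ((siteEquiv F K).symm y') : Matrix.specialUnitaryGroup (Fin 2) ℂ) : Matrix (Fin 2) (Fin 2) ℂ)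
          - ((axialT U₀ c ((siteEquiv F K).symm y) : Matrix.specialUnitaryGroup (Fin 2) ℂ) : Matrix (Fin 2) (Fin 2) ℂ)‖
        ≤ 12 * (48 * ε₀ + a) * (tdist (periodsT3 F K) y y' / ((F.L : ℝ) ^ (K - n))) ^ ((1 : ℝ) / 2) := by
  intro y y' hy hy'
  have hP1 : ∀ i, 1 ≤ periodsT3 F K i := one_le_periodsT3 F K
  have hL1 : (1 : ℝ) ≤ (F.L : ℝ) := by have := F.hL.2; exact_mod_cast this.le
  have hℓ1 : (1 : ℝ) ≤ (F.L : ℝ) ^ (K - n) := one_le_pow₀ hL1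
  have hℓ0 : (0 : ℝ) < (F.L : ℝ) ^ (K - n) := by positivity
  have hη : 0 < eta F n K := eta_pos F n K
  have hℓη : (F.L : ℝ) ^ (K - n) * eta F n K = 1 := by
    unfold eta; rw [← mul_pow, mul_inv_cancel₀ (by positivity), one_pow]
  -- radii
  set R : ℕ := 12 * F.L ^ (K - n) + 4 with hRdef
  have hRℝ : (R : ℝ) = 12 * (F.L : ℝ) ^ (K - n) + 4 := natCast_radius F n K
  have hroom' : 2 * (R + 1) ≤ (F.P K).sitesPerDir 0 := by rw [hRdef]; omega
  set T : ℕ := 8 * F.L ^ (K - n) + 2 with hTdef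
  have hTℝ : (T : ℝ) = 8 * (F.L : ℝ) ^ (K - n) + 2 := by rw [hTdef]; push_cast; ring
  have hT : 2 * (T + 1) ≤ (F.P K).sitesPerDir 0 := by rw [hTdef]; omega
  -- the gauge transformation and the per-step bound on the `R`-ball
  set σ : GaugeTransf (F.P K) 0 (Matrix.specialUnitaryGroup (Fin 2) ℂ) := axialT U₀ c with hσ
  set δ : ℝ := 3 * (R : ℝ) * regThreshold F n K ε₀ with hδdef
  have hℓδ : (F.L : ℝ) ^ (K - n) * δ ≤ 48 * ε₀ := by rw [hδdef]; exact ell_mul_delta_ball_le F n K hε₀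
  have hδ0 : 0 ≤ δ := by rw [hδdef]; unfold regThreshold; positivity
  have hstep : ∀ (z : Site (F.P K) 0) (κ : Fin (F.P K).d), tdist (periodsT3 F K) (siteEquiv F K c) (siteEquiv F K z) ≤ 12 * (F.L : ℝ) ^ (K - n) + 4 →
      ‖((σ (z.shift κ) : Matrix.specialUnitaryGroup (Fin 2) ℂ) : Matrix (Fin 2) (Fin 2) ℂ) - ((σ z : Matrix.specialUnitaryGroup (Fin 2) ℂ) : Matrix (Fin 2) (Fin 2) ℂ)‖
        ≤ δ + a * eta F n K := by
    intro z κ hz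
    have h1 := norm_coe_transf_tgt_sub_le σ U₀ ⟨z, κ⟩
    have hV : ‖((GaugeField.gaugeAct σ U₀ ⟨z, κ⟩ : Matrix.specialUnitaryGroup (Fin 2) ℂ) : Matrix (Fin 2) (Fin 2) ℂ) - 1‖ ≤ δ := by
      have h2 := norm_bgOfCfg_axialT_sub_one_le_of_ball F n K hε₀ U₀ hP c hroom' (siteEquiv F K z) κ (by rw [hRℝ]; exact hz)
      rw [val_bgOfCfg_pair, Equiv.symm_apply_apply] at h2
      rw [hσ]; exact h2
    exact h1.trans (add_le_add hV (hsf ⟨z, κ⟩ hz))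
  -- the two points, the displacement
  set x : Site (F.P K) 0 := (siteEquiv F K).symm y with hx
  set x' : Site (F.P K) 0 := (siteEquiv F K).symm y' with hx'
  have hex : siteEquiv F K x = y := by rw [hx, Equiv.apply_symm_apply]
  have hex' : siteEquiv F K x' = y' := by rw [hx', Equiv.apply_symm_apply]
  set t : B7Prop1Explicit.Site (F.P K).d := rel x x' with htdef
  have hxt : transl x t = x' := by rw [htdef, transl_rel]
  set d : ℝ := tdist (periodsT3 F K) y y' with hd
  have hd0 : 0 ≤ d := tdist_nonneg _ _ _
  have hd8 : d ≤ 8 * (F.L : ℝ) ^ (K - n) + 2 := by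
    have h1 := tdist_triangle hP1 y (siteEquiv F K c) y'
    rw [tdist_symm hP1 y (siteEquiv F K c)] at h1
    linarith [hd]
  have htκ : ∀ κ, ((t κ).natAbs : ℝ) ≤ d := fun κ => by
    have := natAbs_rel_le_tdist_siteEquiv F K x x' κ
    rwa [hex, hex'] at this
  have htT : ∀ κ, |t κ| ≤ (T : ℤ) := fun κ => by
    have h1 : ((t κ).natAbs : ℝ) ≤ (T : ℝ) := (htκ κ).trans (by rw [hTℝ]; exact hd8)
    have h2 : (t κ).natAbs ≤ T := by exact_mod_cast h1
    rw [Int.abs_eq_natAbs]; exact_mod_cast h2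
  -- THE WALK
  have hwalk := norm_sub_le_of_steps F K c x (fun z => ((σ z : Matrix.specialUnitaryGroup (Fin 2) ℂ) : Matrix (Fin 2) (Fin 2) ℂ))
    (β := δ + a * eta F n K) (R₀ := 4 * (F.L : ℝ) ^ (K - n) + 1) (R := 12 * (F.L : ℝ) ^ (K - n) + 4) (T := T)
    hstep (by rw [hex]; exact hy) (by rw [hTℝ]; linarith) hT t htT
  rw [hxt] at hwalk
  -- `|t|₁ ≤ 3d`
  have hn : ((∑ κ, (t κ).natAbs : ℕ) : ℝ) ≤ 3 * d := by
    push_cast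
    calc ∑ κ : Fin (F.P K).d, ((t κ).natAbs : ℝ) ≤ ∑ _κ : Fin (F.P K).d, d := Finset.sum_le_sum fun κ _ => htκ κ
      _ = 3 * d := by rw [Finset.sum_const, Finset.card_univ, Fintype.card_fin, nsmul_eq_mul]; rfl
  -- `3d(δ + aη) = 3(d∕ℓ)(ℓδ + a·ℓη) ≤ 3(d∕ℓ)(48ε₀ + a) ≤ 12(48ε₀ + a)√(d∕ℓ)`
  set r : ℝ := d / (F.L : ℝ) ^ (K - n) with hr
  have hr0 : 0 ≤ r := div_nonneg hd0 hℓ0.le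
  have hr16 : r ≤ 16 := by
    rw [hr, div_le_iff₀ hℓ0]; linarith
  have hsqrt : r ^ ((1 : ℝ) / 2) = Real.sqrt r := (Real.sqrt_eq_rpow r).symm
  have hs4 : Real.sqrt r ≤ 4 := by
    rw [show (4 : ℝ) = Real.sqrt 16 by rw [show (16 : ℝ) = 4 ^ 2 by norm_num, Real.sqrt_sq (by norm_num)]]
    exact Real.sqrt_le_sqrt hr16
  have hβ0 : 0 ≤ 48 * ε₀ + a := by positivity
  calc _ ≤ ((∑ κ, (t κ).natAbs : ℕ) : ℝ) * (δ + a * eta F n K) := hwalk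
    _ ≤ 3 * d * (δ + a * eta F n K) := mul_le_mul_of_nonneg_right hn (by positivity)
    _ = 3 * r * ((F.L : ℝ) ^ (K - n) * δ + a * ((F.L : ℝ) ^ (K - n) * eta F n K)) := by
        rw [hr]; field_simp
    _ ≤ 3 * r * (48 * ε₀ + a) := by
        rw [hℓη, mul_one]; exact mul_le_mul_of_nonneg_left (add_le_add hℓδ le_rfl) (by positivity)
    _ = (Real.sqrt r * (3 * (48 * ε₀ + a))) * Real.sqrt r := by
        rw [show Real.sqrt r * (3 * (48 * ε₀ + a)) * Real.sqrt r = 3 * (Real.sqrt r * Real.sqrt r) * (48 * ε₀ + a) by ring, Real.mul_self_sqrt hr0]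
    _ ≤ (4 * (3 * (48 * ε₀ + a))) * Real.sqrt r :=
        mul_le_mul_of_nonneg_right (mul_le_mul_of_nonneg_right hs4 (by positivity)) (Real.sqrt_nonneg _)
    _ = 12 * (48 * ε₀ + a) * r ^ ((1 : ℝ) / 2) := by rw [hsqrt]; ring

/-- ★★ **THE `hΛ` LETTER OF H2b-GLUE FROM A GLOBAL SMALL-FIELD CLAUSE** (all centres at once): `PlaqSmall`, `∀ b, ‖U₀(b) − 1‖ ≤ a·η`, room ⟹
`‖σ_c(e⁻¹y′) − σ_c(e⁻¹y)‖ ≤ 12(48ε₀ + a)·(tdist y y′∕ℓ)^{1∕2}` on every ball — the per-centre theorem with the clause restricted nowhere.  (A GLOBAL small-field gauge is an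
honest extra hypothesis on a torus member: backgrounds with non-central Polyakov loops on few-block members have none; the per-centre edition is the dischargeable one.)
[cite: Balaban1985Averaging, pp.24-25; Balaban1985BackgroundPropagators, (3.35) p.396] -/
theorem norm_axialT_sub_le_of_smallField {ε₀ a : ℝ} (hε₀ : 0 ≤ ε₀) (ha : 0 ≤ a)
    (U₀ : GaugeField (F.P K) 0 (Matrix.specialUnitaryGroup (Fin 2) ℂ)) (hP : PlaqSmall (regThreshold F n K ε₀) U₀)
    (hsf : ∀ b : PBond (F.P K) 0, ‖((U₀ b : Matrix.specialUnitaryGroup (Fin 2) ℂ) : Matrix (Fin 2) (Fin 2) ℂ) - 1‖ ≤ a * eta F n K)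
    (hroom : 2 * (12 * F.L ^ (K - n) + 5) ≤ (F.P K).sitesPerDir 0) :
    ∀ (c : Site (F.P K) 0) (y y' : TSite 3 (periodsT3 F K)),
      tdist (periodsT3 F K) (siteEquiv F K c) y ≤ 4 * (F.L : ℝ) ^ (K - n) + 1 → tdist (periodsT3 F K) (siteEquiv F K c) y' ≤ 4 * (F.L : ℝ) ^ (K - n) + 1 →
      ‖((axialT U₀ c ((siteEquiv F K).symm y') : Matrix.specialUnitaryGroup (Fin 2) ℂ) : Matrix (Fin 2) (Fin 2) ℂ)
          - ((axialT U₀ c ((siteEquiv F K).symm y) : Matrix.specialUnitaryGroup (Fin 2) ℂ) : Matrix (Fin 2) (Fin 2) ℂ)‖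
        ≤ 12 * (48 * ε₀ + a) * (tdist (periodsT3 F K) y y' / ((F.L : ℝ) ^ (K - n))) ^ ((1 : ℝ) / 2) :=
  fun c => norm_axialT_sub_le_of_smallField_ball F n K hε₀ ha U₀ hP c (fun b _ => hsf b) hroom

end Summit.QuantumFields.YangMills.Theorems.Prop7AxialTransporterModulus

end
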